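import Summits.ResolutionOfSingularities.ResolutionOfSingularities.Theorems.DeltaFaceCutClasses

/-!
# DeltaFaceCutKernels — the PROVED pure-logic kernels of node N60 `DeltaFaceCut` (decomp-res lens-2 g11)

Companion of `Theorems.DeltaFaceCutClasses` (vocabulary, engine, paper proofs).  Contents: the sanity values of `thetaNum` /
`packageLength`; the pointwise trichotomy-plus-one (`classGE_or_generic_or_dspecial`, `not_gen_of_isDeltaSpecialPt`); the
EXACT split of the fresh-data frame at marking `n`, `SeqDimFour 1 n ⟺ SeqDGen n ∧ SeqDSpec n`
(`seqDimFour_one_iff`) with its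
projections; the comparison with the g9 families (`seqGen_of_seqDGen`, `seqDSpec_of_seqSpec`); the EXACT sub-splits of the
δ-special family into the slope strata FAR / MID / CRIT (`seqDSpec_iff`) and into the isolation columns NONISO / ISO
(`seqDSpec_iff_iso`); THE ENGINES AT WORK (`dGenRungAt_of_engines`, `dGenRungAt_one`, `deltaGenericRung_of_engines`:
`DeltaGenericRung` is DECIDED modulo `FaceFormExit`, `DeltaPackageExit`, `PackagePort`, `OrderOneContact`); the rung-level
EXACT splits of `DeltaSpecialRung` (`deltaSpecialRung_iff_strata`, `deltaSpecialRung_iff_iso`) and `e_one_iff_families`.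
Theses-free; the by-name wiring to `MaxContactCut.RungOne` 29273 and the asides is `Theorems.MaxContactCutDeltaFaceCut`.
All proofs are pure logic (`[folklore]`).  0 `sorry`.
-/

open CategoryTheory AlgebraicGeometry TopologicalSpace IsLocalRing
open Literature.AlgebraicGeometry.Resolution
open Summit.ResolutionOfSingularities.ResolutionOfSingularities.Theorems
open Summit.ResolutionOfSingularities.ResolutionOfSingularities.Theorems.WeakOrderReduction
open DeltaFaceCutClasses

namespace Summit.ResolutionOfSingularities.ResolutionOfSingularities.Theorems.DeltaFaceCutKernels

/-! ## Sanity values of the weights (§0) -/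

example : thetaNum 3 2 = 1 := by decide          -- δ = 3/2: θ = 1/2
example : thetaNum 7 3 = 2 := by decide          -- δ = 7/3: θ = 2/3
example : thetaNum 5 4 = 3 := by decide          -- δ = 1 + 1/4 (g9/g10 at n = 4): θ = 3/4, threshold θ·n = 3 = n − 1
example : packageLength 3 2 = 1 := by decide     -- δ = 3/2: one blow-up
example : packageLength 5 2 = 2 := by decide     -- δ = 5/2: blow up y, then C₁
example : packageLength 6 2 = 2 := by decide     -- δ = 3 ∈ ℤ: blow up y, then C₁; solvability test on C₂

/-! ## §5  Kernels — pure logic (0 sorry) -/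

section Kernels

variable {n : ℕ}


/-- Pointwise: a top point is of class ≥ 2 or face-generic, or δ-generic, or δ-special. [folklore] -/
theorem classGE_or_generic_or_dspecial {k : Type} [Field k] {Y : Scheme.{0}} (g : Y ⟶ Spec (.of k))
    (hY : Scheme.IsRegular Y) (I : Y.IdealSheafData) (n : ℕ) (y : Y) :
    ((ClassGE g hY I n 2 y ∨ FaceFormCutClasses.IsFaceGenericPt I n y) ∨ IsDeltaGenericPt I n y) ∨
      IsDeltaSpecialPt g hY I n y := by
  rcases FaceFormCutClasses.classGE_or_generic_or_special g hY I n y with h | h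
  · exact Or.inl (Or.inl h)
  · by_cases hD : IsDeltaGenericPt I n y
    · exact Or.inl (Or.inr hD)
    · exact Or.inr ⟨h, hD⟩

/-- A δ-special point is neither of class ≥ 2 / face-generic nor δ-generic. [folklore] -/
theorem not_gen_of_isDeltaSpecialPt {k : Type} [Field k] {Y : Scheme.{0}} {g : Y ⟶ Spec (.of k)}
    {hY : Scheme.IsRegular Y} {I : Y.IdealSheafData} {n : ℕ} {y : Y} (h : IsDeltaSpecialPt g hY I n y) :
    ¬ ((ClassGE g hY I n 2 y ∨ FaceFormCutClasses.IsFaceGenericPt I n y) ∨ IsDeltaGenericPt I n y) := by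
  rintro ((hc | hf) | hd)
  · exact h.1.1 hc
  · exact h.1.2 hf
  · exact h.2 hd

/-- **EXACT at each marking**: `SeqDimFour 1 n ⟺ SeqDGen n ∧ SeqDSpec n` (excluded middle on «some top point is
δ-special»). [folklore] -/
theorem seqDimFour_one_iff : SeqDimFour 1 n ↔ SeqDGen n ∧ SeqDSpec n := by
  constructor
  · intro h
    refine ⟨?_, ?_⟩
    · intro p hp k _ _ Y g h1 h2 h3 hY h4 I hord _
      exact h p hp k Y g h1 h2 h3 hY h4 I hord (fun y _ => Or.inl le_rfl)
    · intro p hp k _ _ Y g h1 h2 h3 hY h4 I hord _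
      exact h p hp k Y g h1 h2 h3 hY h4 I hord (fun y _ => Or.inl le_rfl)
  · rintro ⟨hG, hS⟩ p hp k _ _ Y g h1 h2 h3 hY h4 I hord _
    by_cases hex : ∃ y : Y, idealOrder I y = ((n : ℕ) : ℕ∞) ∧ IsDeltaSpecialPt g hY I n y
    · exact hS p hp k Y g h1 h2 h3 hY h4 I hord hex
    · refine hG p hp k Y g h1 h2 h3 hY h4 I hord ?_
      intro y hy
      rcases classGE_or_generic_or_dspecial g hY I n y with h | h
      · exact h
      · exact absurd ⟨y, hy, h⟩ hex

/-- The two classes at one marking give all data. [folklore] -/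
theorem seqDimFour_one_of_dgen_dspec (hG : SeqDGen n) (hS : SeqDSpec n) : SeqDimFour 1 n :=
  seqDimFour_one_iff.mpr ⟨hG, hS⟩

/-- `SeqDGen n` is `SeqDimFour 1 n` restricted: weaker BY LETTER. [folklore] -/
theorem seqDGen_of_seqDimFour_one (h : SeqDimFour 1 n) : SeqDGen n := (seqDimFour_one_iff.mp h).1

/-- `SeqDSpec n` is `SeqDimFour 1 n` restricted: weaker BY LETTER. [folklore] -/
theorem seqDSpec_of_seqDimFour_one (h : SeqDimFour 1 n) : SeqDSpec n := (seqDimFour_one_iff.mp h).2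

/-- `SeqDimFour 2 n` is `SeqDGen n` restricted. [folklore] -/
theorem seqDimFour_two_of_seqDGen (h : SeqDGen n) : SeqDimFour 2 n := by
  intro p hp k _ _ Y g h1 h2 h3 hY h4 I hord hcls
  exact h p hp k Y g h1 h2 h3 hY h4 I hord (fun y hy => Or.inl (Or.inl (hcls y hy)))

/-- g9's `SeqGen n` is `SeqDGen n` restricted (the δ-generic class ENLARGES the decided class). [folklore] -/
theorem seqGen_of_seqDGen (h : SeqDGen n) : FaceFormCutClasses.SeqGen n := by
  intro p hp k _ _ Y g h1 h2 h3 hY h4 I hord hcls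
  exact h p hp k Y g h1 h2 h3 hY h4 I hord (fun y hy => Or.inl (hcls y hy))

/-- g9's located class `SeqSpec n` gives the δ-special located class (δ-special ⇒ face-special). [folklore] -/
theorem seqDSpec_of_seqSpec (h : FaceFormCutClasses.SeqSpec n) : SeqDSpec n := by
  intro p hp k _ _ Y g h1 h2 h3 hY h4 I hord hex
  obtain ⟨y, hy, hs⟩ := hex
  exact h p hp k Y g h1 h2 h3 hY h4 I hord ⟨y, hy, hs.1⟩

/-- **EXACT sub-cut of the located class**: `SeqDSpec n ⟺ SeqDSpecFar n ∧ SeqDSpecMid n ∧ SeqDSpecCrit n` (nested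
excluded middle on «some δ-special top point is far» and «some face-special top point is deep-faced»). [folklore] -/
theorem seqDSpec_iff : SeqDSpec n ↔ SeqDSpecFar n ∧ SeqDSpecMid n ∧ SeqDSpecCrit n := by
  constructor
  · intro h
    refine ⟨?_, ?_, ?_⟩
    · intro p hp k _ _ Y g h1 h2 h3 hY h4 I hord hex
      obtain ⟨y, hy, hs, -⟩ := hex
      exact h p hp k Y g h1 h2 h3 hY h4 I hord ⟨y, hy, hs⟩
    · intro p hp k _ _ Y g h1 h2 h3 hY h4 I hord hex _ _
      exact h p hp k Y g h1 h2 h3 hY h4 I hord hex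
    · intro p hp k _ _ Y g h1 h2 h3 hY h4 I hord hex _
      exact h p hp k Y g h1 h2 h3 hY h4 I hord hex
  · rintro ⟨hF, hM, hC⟩ p hp k _ _ Y g h1 h2 h3 hY h4 I hord hex
    by_cases hfar : ∃ y : Y, idealOrder I y = ((n : ℕ) : ℕ∞) ∧ IsDeltaSpecialPt g hY I n y ∧ IsFarPt I n y
    · exact hF p hp k Y g h1 h2 h3 hY h4 I hord hfar
    by_cases hdeep : ∃ y : Y, idealOrder I y = ((n : ℕ) : ℕ∞) ∧
        FaceFormCutClasses.IsFaceSpecialPt g hY I n y ∧ FaceFormCutClasses.IsDeepFacePt I n y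
    · refine hM p hp k Y g h1 h2 h3 hY h4 I hord hex ?_ hdeep
      intro y hy hs hfy
      exact hfar ⟨y, hy, hs, hfy⟩
    · refine hC p hp k Y g h1 h2 h3 hY h4 I hord hex ?_
      intro y hy hs hd
      exact hdeep ⟨y, hy, hs, hd⟩

/-- The three strata give the located class (`mpr`, by name for probes). [folklore] -/
theorem seqDSpec_of_strata (hF : SeqDSpecFar n) (hM : SeqDSpecMid n) (hC : SeqDSpecCrit n) : SeqDSpec n :=
  seqDSpec_iff.mpr ⟨hF, hM, hC⟩

/-- **EXACT isolation sub-cut of the located class**: `SeqDSpec n ⟺ SeqDSpecNonIso n ∧ SeqDSpecIso n` (excluded middle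
on «some δ-special top point is non-isolated in the top locus»).  [folklore] -/
theorem seqDSpec_iff_iso : SeqDSpec n ↔ SeqDSpecNonIso n ∧ SeqDSpecIso n := by
  constructor
  · intro h
    refine ⟨?_, ?_⟩
    · intro p hp k _ _ Y g h1 h2 h3 hY h4 I hord hex
      obtain ⟨y, hy, hs, -⟩ := hex
      exact h p hp k Y g h1 h2 h3 hY h4 I hord ⟨y, hy, hs⟩
    · intro p hp k _ _ Y g h1 h2 h3 hY h4 I hord hex _
      exact h p hp k Y g h1 h2 h3 hY h4 I hord hex
  · rintro ⟨hN, hI⟩ p hp k _ _ Y g h1 h2 h3 hY h4 I hord hex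
    by_cases hni : ∃ y : Y, idealOrder I y = ((n : ℕ) : ℕ∞) ∧ IsDeltaSpecialPt g hY I n y ∧
        ¬ FaceFormCutClasses.IsIsolatedTop I n y
    · exact hN p hp k Y g h1 h2 h3 hY h4 I hord hni
    · refine hI p hp k Y g h1 h2 h3 hY h4 I hord hex ?_
      intro y hy hs
      by_contra hiso
      exact hni ⟨y, hy, hs, hiso⟩

/-- The two isolation columns give the located class (`mpr`, by name for probes). [folklore] -/
theorem seqDSpec_of_iso (hN : SeqDSpecNonIso n) (hI : SeqDSpecIso n) : SeqDSpec n :=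
  seqDSpec_iff_iso.mpr ⟨hN, hI⟩

/-- A FAR-free consequence: the non-isolated column is implied by the located class (WEAKER by letter). [folklore] -/
theorem seqDSpecNonIso_of_seqDSpec (h : SeqDSpec n) : SeqDSpecNonIso n := (seqDSpec_iff_iso.mp h).1

/-- The isolated column is implied by the located class (WEAKER by letter). [folklore] -/
theorem seqDSpecIso_of_seqDSpec (h : SeqDSpec n) : SeqDSpecIso n := (seqDSpec_iff_iso.mp h).2

/-- **THE ENGINES AT WORK (pure logic given the typed pieces)**: the tree engine `FaceFormExit` turns every
face-generic top point into a one-shot EXIT point, the new engine `DeltaPackageExit` turns every δ-generic top point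
into a PACKAGE-EXIT point, and the engine-free port `PackagePort n` does the bookkeeping: `DGenRungAt n` for `n ≥ 2`.
[folklore] -/
theorem dGenRungAt_of_engines (hF : FaceFormCutClasses.FaceFormExit) (hD : DeltaPackageExit) (hP : PackagePort n)
    (hn : 2 ≤ n) : DGenRungAt n := by
  intro h2 p hp k _ _ Y g hg1 hg2 hg3 hY h4 I hord hcls
  refine hP h2 p hp k Y g hg1 hg2 hg3 hY h4 I hord ?_
  intro y hy
  rcases hcls y hy with (h | ⟨hcl, hiso, d, c, hc, hfr, hface⟩) | ⟨hcl, hiso, d, c, hc, hfr, a, b, F, hface, hgen⟩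
  · exact Or.inl h
  · exact Or.inr (Or.inl ⟨hcl, hiso, d, c, hc, hfr, hF Y I n hn y (hY y) d c hc hfr hface⟩)
  · exact Or.inr (Or.inr ⟨hcl, hiso, hD Y hY I n hn y hcl hy d c hc hfr a b F hface hgen⟩)

/-- At marking `1` every top point is a contact point (tree port `OrderOneContact`), hence of class ≥ 2: `DGenRungAt 1`
with no blow-up at all. [folklore] -/
theorem dGenRungAt_one (h1 : FaceFormCutClasses.OrderOneContact) : DGenRungAt 1 := by
  intro h2 p hp k _ _ Y g hg1 hg2 hg3 hY h4 I hord _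
  refine h2 p hp k Y g hg1 hg2 hg3 hY h4 I hord ?_
  intro y hy
  exact Or.inr (Or.inl (h1 p hp k Y g hg1 hg2 hg3 hY I y hy))

/-- **`DeltaGenericRung` is DECIDED modulo the typed pieces**: the two engines, the package port at every marking
`≥ 2`, and the order-one contact port. [folklore] -/
theorem deltaGenericRung_of_engines (hF : FaceFormCutClasses.FaceFormExit) (hD : DeltaPackageExit)
    (hP : ∀ n : ℕ, 2 ≤ n → PackagePort n) (h1 : FaceFormCutClasses.OrderOneContact) : DeltaGenericRung := by
  intro hE2 n hn
  by_cases h : 2 ≤ n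
  · exact dGenRungAt_of_engines hF hD (hP n h) h (hE2 n hn)
  · have hn1 : n = 1 := by omega
    subst hn1
    exact dGenRungAt_one h1 (hE2 1 hn)

/-- The located residual split at the rung into the three strata (EXACT). [folklore] -/
theorem deltaSpecialRung_iff_strata : DeltaSpecialRung ↔
    (E 2 → ∀ n : ℕ, 1 ≤ n → SeqDSpecFar n) ∧ (E 2 → ∀ n : ℕ, 1 ≤ n → SeqDSpecMid n) ∧
      (E 2 → ∀ n : ℕ, 1 ≤ n → SeqDSpecCrit n) :=
  ⟨fun h => ⟨fun hE2 n hn => (seqDSpec_iff.mp (h hE2 n hn)).1, fun hE2 n hn => (seqDSpec_iff.mp (h hE2 n hn)).2.1,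
      fun hE2 n hn => (seqDSpec_iff.mp (h hE2 n hn)).2.2⟩,
    fun h hE2 n hn => seqDSpec_iff.mpr ⟨h.1 hE2 n hn, h.2.1 hE2 n hn, h.2.2 hE2 n hn⟩⟩

/-- The located residual split at the rung into the two ISOLATION columns (EXACT). [folklore] -/
theorem deltaSpecialRung_iff_iso : DeltaSpecialRung ↔
    (E 2 → ∀ n : ℕ, 1 ≤ n → SeqDSpecNonIso n) ∧ (E 2 → ∀ n : ℕ, 1 ≤ n → SeqDSpecIso n) :=
  ⟨fun h => ⟨fun hE2 n hn => (seqDSpec_iff_iso.mp (h hE2 n hn)).1, fun hE2 n hn => (seqDSpec_iff_iso.mp (h hE2 n hn)).2⟩,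
    fun h hE2 n hn => seqDSpec_iff_iso.mpr ⟨h.1 hE2 n hn, h.2 hE2 n hn⟩⟩

/-- `E 1` ⟺ the two families at every marking (EXACT, family level). [folklore] -/
theorem e_one_iff_families : E 1 ↔ (∀ n : ℕ, 1 ≤ n → SeqDGen n) ∧ (∀ n : ℕ, 1 ≤ n → SeqDSpec n) :=
  ⟨fun h => ⟨fun n hn => seqDGen_of_seqDimFour_one (h n hn), fun n hn => seqDSpec_of_seqDimFour_one (h n hn)⟩,
    fun h n hn => seqDimFour_one_iff.mpr ⟨h.1 n hn, h.2 n hn⟩⟩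

end Kernels

end Summit.ResolutionOfSingularities.ResolutionOfSingularities.Theorems.DeltaFaceCutKernels
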